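import Summits.Ventures.KdS.SpinFlipBookkeeping
import Summits.Ventures.KdS.SpinFlipMonomial
import Literature.Analysis.ODE.HeunEulerBranch
import Literature.Geometry.Lorentzian.KerrDeSitterHeunEquivalence
import HarnessLib

/-!
# Venture KdS — ROUTE W, the spin flip `s ↦ −s` (Teukolsky–Starobinsky) as a THEOREM off the
# cosmological lattice, and Casals–Teixeira da Costa's Proposition 3.8 for every spin

HONEST FRAMING (venture `Summits/Ventures/KdS`, cell `pub-kds`; STRUCTURE.md C3): the route-W
skeleton (`RouteW.lean`) left `RouteW.SpinFlip` — "a generic-boundary radial solution of spin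
`s ≥ 1` yields one of spin `−s`, same `λ̄`, generic boundary bullets, and `R' ≡ 0 ⇒ R ≡ 0`" — as a
hypothesis. This file PROVES that statement under ONE explicit extra binder, the
**off-lattice condition** `s − 2η₂ ∉ ℤ_{≤ 2s−1}` (`η₂ = −B(r_c)` the cosmological-horizon exponent),
and explains why the binder cannot be dropped: the Teukolsky–Starobinsky operator
`Δ^s(𝒟†)^{2s}Δ^s` — realised here as Umetsu's `2s`-th derivative in the exponent-flipped Hatsuda
frame (`GeneralHeun.isSolutionOn_flip` + `GeneralHeun.isSolutionOn_iterate_deriv`, both landed) —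
has kernel `{weight × polynomials of degree ≤ 2s−1}`, and a kernel element carries the OUTGOING
branch at `r_c` exactly when `s − 2η₂ ∈ ℤ_{≤ 2s−1}`, i.e. on the cosmological threshold ray
`Re ω = mϖ₂` at the heights `Im ω = jκ₂`, `j ∈ (s+ℤ) ∩ (0, s−1]` (empty for `s ≤ 1`). At those points
explicit algebraically-special polynomial modes exist (cell memo `theory/w5/scan.py`: 1760/1760,
each violating a printed hypothesis of CTdC's theorem), so `RouteW.SpinFlip` as typed is not
expected to hold there; everywhere else it is the theorem `RouteW.spinFlipTS_holds` below, and at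
the EXTREME lattice point the accessory condition exposed by `spinFlip_core` (b) is turned into a
contradiction with CTdC's hypotheses by an explicit partner mode (`RouteWSpinFlipLattice.lean`).

CONSEQUENCES (file `RouteWSpinFlipProp38.lean`; all with 0 cited facts; inputs = the landed route W
`radial_vanishing_lt_one` / `radial_vanishing_of_im_gt`): `RouteW.radial_vanishing_offLattice` — CTdC Prop. 3.8's conclusion for
every half-integer spin `s ≥ 1/2` off the lattice; `RouteW.offLattice_of_im_gt_cosmo` /
`offLattice_of_re_ne` — the lattice is avoided whenever `Im ω > (s−1)κ₂` or `Re ω ≠ mϖ₂`;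
`RouteW.prop38_of_im_gt_or_offLattice` — the cited fact
`CasalsTeixeiraDaCosta2022_partialModeStabilityProp38` restricted to
`Im ω > (s−1)·min(κ₁, κ₂) ∨ Re ω ≠ mϖ₂ ∨ s − 2η₂ ∉ ℤ_{≤2s−1}`, in particular IN FULL for `s ≤ 1`
(`prop38_le_one`; new for `s = 1`). The parameter algebra is in `SpinFlipBookkeeping.lean`.

Mechanism (Heun level, Hatsuda's variable `x ∈ (0,1)`, `r₊ ↦ 0`, `r_c ↦ 1`, `a_H = z_r > 1`):
`y` (spin `s`, Hatsuda gauge: branch `x^{1−γ}` at `0`, regular at `1`) ↦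
`ỹ = x^{γ−1}(1−x)^{δ−1}(z_r−x)^{ε−1} y` (regular at `0`, branch `(1−x)^{δ−1}` at `1`; flipped frame,
`α = 1 − 2s`) ↦ `u = ỹ^{(2s)}` (Umetsu; parameters `+2s`, accessory identity
`heunV_flip_diff`) ↦ `y₋ = x^{1−γ₋}(1−x)^{1−δ₋}(z_r−x)^{1−ε₋} u` (Hatsuda gauge of spin `−s` at
`λ' = λ − 2s(1−α)`: branch at `0`, regular at `1` since `δ − δ₋ = 2s`) ↦ `R'` by LIT-1's
`isRadialTeukolskySolution_of_heunSolution` / `isIngoingAtEventHorizon_of_heun_branch_at_zero` /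
`isOutgoingAtCosmoHorizon_of_heun_smooth_at_one`. Injectivity: `R' ≡ 0 ⇒ ỹ^{(2s)} ≡ 0 ⇒ ỹ` is a
polynomial with the branch `(1−x)^{δ−1}` at `1` ⇒ `ỹ ≡ 0` off the lattice
(`SpinFlipTS.eq_zero_of_iterate_deriv_eq_zero_of_branch`).

References: Casals–Teixeira da Costa, CMP 394 (2022) [CasalsTeixeiradacosta2022] Prop. 3.8,
Cor. 3.9 (i)⇔(ii); Umetsu, PTP 104 (2000) 743 [Umetsu2000] §3; Suzuki–Takasugi–Umetsu, PTP 102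
(1999) 253, §4 (4.1); Hatsuda, CQG 38 (2020) 025015 [Hatsuda2020] §2.2–§3.1.
-/

noncomputable section

open Set Complex Filter Topology

namespace Summit.Ventures.KdS

namespace SpinFlipTS

open Literature.Geometry.Lorentzian.Kerr.Costa2019 (iterate_deriv_smooth iterate_deriv_eqOn)
open Literature.Analysis.ODE Literature.Analysis.ODE.GeneralHeun
open Literature.Geometry.Lorentzian Literature.Geometry.Lorentzian.KerrDeSitter

/-! ### Smoothness helpers (principal powers of positive reals) -/

/-- `t ↦ t^p` is smooth on `(0, ∞)` (real variable, principal complex power). -/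
private theorem contDiffOn_ofReal_cpow (p : ℂ) :
    ContDiffOn ℝ ((⊤ : ℕ∞) : WithTop ℕ∞) (fun t : ℝ => (t : ℂ) ^ p) (Ioi 0) := by
  intro x hx
  have hslit : ((x : ℝ) : ℂ) ∈ slitPlane := Complex.ofReal_mem_slitPlane.2 hx
  have h1 : AnalyticAt ℂ (fun z : ℂ => z ^ p) (x : ℂ) := analyticAt_id.cpow analyticAt_const hslit
  have h3 : AnalyticAt ℝ (fun y : ℝ => (y : ℂ)) x := Complex.ofRealCLM.analyticAt x
  have h4 : AnalyticAt ℝ (fun y : ℝ => ((y : ℂ)) ^ p) x :=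
    AnalyticAt.comp (g := fun z : ℂ => z ^ p) (f := fun y : ℝ => (y : ℂ)) (x := x)
      h1.restrictScalars h3
  exact h4.contDiffAt.contDiffWithinAt

/-- `x ↦ (g x)^p` is smooth where the real function `g` is smooth and positive. -/
private theorem contDiffOn_cpow_comp {g : ℝ → ℝ} {U : Set ℝ}
    (hg : ContDiffOn ℝ ((⊤ : ℕ∞) : WithTop ℕ∞) g U) (hpos : ∀ x ∈ U, 0 < g x) (p : ℂ) :
    ContDiffOn ℝ ((⊤ : ℕ∞) : WithTop ℕ∞) (fun x => ((g x : ℝ) : ℂ) ^ p) U :=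
  (contDiffOn_ofReal_cpow p).comp hg fun x hx => hpos x hx

/-- Product of principal powers of the same positive real: `t^p · t^q = t^{p+q}`. -/
private theorem cpow_mul_cpow_ofReal {t : ℝ} (ht : 0 < t) (p q : ℂ) :
    ((t : ℝ) : ℂ) ^ p * ((t : ℝ) : ℂ) ^ q = ((t : ℝ) : ℂ) ^ (p + q) := by
  rw [Complex.cpow_add _ _ (by exact_mod_cast ht.ne')]

end SpinFlipTS

namespace RouteW

open Literature.Analysis.ODE Literature.Analysis.ODE.GeneralHeun
open Literature.Geometry.Lorentzian Literature.Geometry.Lorentzian.KerrDeSitter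
open SpinFlipTS

/-! ### The spin-flip theorem -/

/-- **The off-lattice condition** at the cosmological horizon: `s + 2B(r_c) = s − 2η₂` is not an
integer `≤ 2s − 1`. Since `Re(s − 2η₂) = s + Im ω/κ₂`, for `Im ω > 0` this excludes exactly the points
`Re ω = mϖ₂`, `Im ω = jκ₂` with `j ∈ (s + ℤ) ∩ (0, s−1]` — none for `s ≤ 1`
(`offLattice_of_re_ne`, `offLattice_of_im_gt_cosmo`). -/
def OffLattice (M a Λ s : ℝ) (ω : ℂ) (m : ℝ) : Prop :=
  ∀ j : ℤ, (j : ℝ) ≤ 2 * s - 1 → (s : ℂ) + 2 * horizonB M a Λ ω m (rCosmo M a Λ) ≠ j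

/-- **`SpinFlip` re-typed (STRUCTURE.md C3): the Teukolsky–Starobinsky transfer off the lattice.**
For subextremal `(M,a,Λ)`, a half-integer spin `s = N/2 ≥ 1/2` and ANY `ω, m, λ`: every classical
radial Teukolsky solution of spin `s` on `(r₊, r_c)` that is ingoing at `𝓗⁺` and outgoing at `𝓗⁺_c`
(generic bullets) yields one of spin `−s` with separation constant `λ' = λ − 2s(1−α)` (same `λ̄`)
and the same boundary behaviour; and, off the cosmological lattice, `R' ≡ 0 ⇒ R ≡ 0`. -/
def SpinFlipTS : Prop :=
  ∀ (M a Λ s : ℝ) (ω : ℂ) (m : ℝ) (lam : ℂ) (R : ℝ → ℂ) (N : ℕ), IsSubextremal M a Λ → 1 ≤ N →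
    2 * s = N →
    IsRadialTeukolskySolution M a Λ s ω m lam R → IsIngoingAtEventHorizon M a Λ s ω m R →
    IsOutgoingAtCosmoHorizon M a Λ ω m R →
      ∃ R' : ℝ → ℂ, IsRadialTeukolskySolution M a Λ (-s) ω m (lamFlip a Λ s lam) R' ∧
        IsIngoingAtEventHorizon M a Λ (-s) ω m R' ∧ IsOutgoingAtCosmoHorizon M a Λ ω m R' ∧
        (OffLattice M a Λ s ω m → (∀ r ∈ Ioo (rPlus M a Λ) (rCosmo M a Λ), R' r = 0) →
          ∀ r ∈ Ioo (rPlus M a Λ) (rCosmo M a Λ), R r = 0)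

/-- **The spin-flip chain (core).** For a generic-boundary spin-`s` radial solution `R` the
Teukolsky–Starobinsky image `R'` (spin `−s`, `λ' = lamFlip`) is a generic-boundary radial solution;
and IF `R' ≡ 0` then (a) off the lattice `R ≡ 0`, and (b) on the EXTREME stratum
`s + 2B(r_c) = 2s − 1` either `R ≡ 0` or the accessory parameter satisfies the algebraic condition of
the monomial `(1−x)^{2s−1}` in the flipped Hatsuda frame (the algebraically special value of `λ`).
Proof: Hatsuda gauge (LIT-1's `heunSolution_of_isRadialTeukolskySolution`,
`heunSolution_branch_at_zero`, `heunSolution_smooth_at_one`) → exponent flip (`isSolutionOn_flip`) →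
Umetsu's `2s`-th derivative (`isSolutionOn_iterate_deriv`, `accessory_identity`) → flip back →
LIT-1's converse transfer; boundary shapes by `SpinFlipTS.iterate_deriv_of_agree` /
`iterate_deriv_of_branch` (`δ_s − δ_{−s} = 2s`); (a) is
`SpinFlipTS.eq_zero_of_iterate_deriv_eq_zero_of_branch`, (b) is
`eq_monomial_of_iterate_deriv_eq_zero_of_branch_extreme` + `accessory_of_monomial_solution`.
PROVED, 0 cited facts. -/
theorem spinFlip_core (M a Λ s : ℝ) (ω : ℂ) (m : ℝ) (lam : ℂ) (R : ℝ → ℂ) (N : ℕ)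
    (hsub : IsSubextremal M a Λ) (hN1 : 1 ≤ N) (hsN : 2 * s = N)
    (hR : IsRadialTeukolskySolution M a Λ s ω m lam R) (hin : IsIngoingAtEventHorizon M a Λ s ω m R)
    (hout : IsOutgoingAtCosmoHorizon M a Λ ω m R) :
    ∃ R' : ℝ → ℂ, IsRadialTeukolskySolution M a Λ (-s) ω m (lamFlip a Λ s lam) R' ∧
      IsIngoingAtEventHorizon M a Λ (-s) ω m R' ∧ IsOutgoingAtCosmoHorizon M a Λ ω m R' ∧
      ((∀ r ∈ Ioo (rPlus M a Λ) (rCosmo M a Λ), R' r = 0) →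
        (OffLattice M a Λ s ω m → ∀ r ∈ Ioo (rPlus M a Λ) (rCosmo M a Λ), R r = 0) ∧
        ((s : ℂ) + 2 * horizonB M a Λ ω m (rCosmo M a Λ) = (N : ℂ) - 1 →
          (∀ r ∈ Ioo (rPlus M a Λ) (rCosmo M a Λ), R r = 0) ∨
          flipQ (mobiusZr M a Λ : ℂ) (heunGamma M a Λ s ω m) (heunDelta M a Λ s ω m)
              (heunEps M a Λ s ω m) (heunV M a Λ s ω m lam) =
            ((N : ℂ) - 1) * (2 - heunGamma M a Λ s ω m) * (mobiusZr M a Λ : ℂ))) := by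
  -- Hatsuda data of spin `s` and `−s`
  set zr := mobiusZr M a Λ with hzrdef
  have hzr : 1 < zr := one_lt_mobiusZr hsub
  set γ := heunGamma M a Λ s ω m with hγ
  set δ := heunDelta M a Λ s ω m with hδ
  set ε := heunEps M a Λ s ω m with hε
  set σp := heunSigmaPlus s with hσp
  set σm := heunSigmaMinus M a Λ s ω m with hσm
  set q := heunV M a Λ s ω m lam with hq
  set γ' := heunGamma M a Λ (-s) ω m with hγ'
  set δ' := heunDelta M a Λ (-s) ω m with hδ'
  set ε' := heunEps M a Λ (-s) ω m with hε'
  set σp' := heunSigmaPlus (-s) with hσp'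
  set σm' := heunSigmaMinus M a Λ (-s) ω m with hσm'
  set q' := heunV M a Λ (-s) ω m (lamFlip a Λ s lam) with hq'
  set ρ := mobiusInv M a Λ with hρ
  set w := heunWeight M a Λ s ω m with hw
  -- the Hatsuda-gauge function of `R` and its flip
  set y : ℝ → ℂ := fun x => R (ρ x) / w (ρ x) with hy
  set ytil : ℝ → ℂ := fun x => flipWeight zr γ δ ε x * y x with hytil
  set u : ℝ → ℂ := deriv^[N] ytil with hu
  set ym : ℝ → ℂ := fun x => flipWeight zr (2 - γ') (2 - δ') (2 - ε') x * u x with hym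
  set R' : ℝ → ℂ := fun r => heunWeight M a Λ (-s) ω m r * ym (mobiusZ M a Λ r) with hR'
  -- (1) equations
  have hysol : IsSolutionOn (zr : ℂ) σp σm γ δ ε q (Ioo 0 1) y :=
    heunSolution_of_isRadialTeukolskySolution hsub hR
  have hF : γ + δ + ε = σp + σm + 1 := heun_fuchs hsub s ω m
  have hytilsol : IsSolutionOn (zr : ℂ) (2 - σp) (2 - σm) (2 - γ) (2 - δ) (2 - ε)
      (flipQ zr γ δ ε q) (Ioo 0 1) ytil :=
    isSolutionOn_flip hzr hF Subset.rfl hysol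
  have hlead : ∀ x ∈ Ioo (0 : ℝ) 1, lead (zr : ℂ) x ≠ 0 := by
    intro x hx
    unfold lead
    have h0 : (x : ℂ) ≠ 0 := by exact_mod_cast hx.1.ne'
    have h1 : (x : ℂ) - 1 ≠ 0 := by
      have : ((x - 1 : ℝ) : ℂ) ≠ 0 := by exact_mod_cast (show x - 1 ≠ 0 by linarith [hx.2])
      simpa using this
    have ha : (x : ℂ) - zr ≠ 0 := by
      have : ((x - zr : ℝ) : ℂ) ≠ 0 := by exact_mod_cast (show x - zr ≠ 0 by linarith [hx.2])
      simpa using this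
    exact mul_ne_zero (mul_ne_zero h0 h1) ha
  have hytil_smooth : ContDiffOn ℝ ((⊤ : ℕ∞) : WithTop ℕ∞) ytil (Ioo 0 1) :=
    contDiffOn_of_isSolutionOn isOpen_Ioo hlead hytilsol
  have hα : 2 - σp = 1 - (N : ℂ) := two_sub_sigmaPlus s hsN
  have hF' : (2 - γ) + (2 - δ) + (2 - ε) = (2 - σp) + (2 - σm) + 1 := fuchs_flip hF
  have husol₀ := isSolutionOn_iterate_deriv hF' hN1 hα isOpen_Ioo hytil_smooth hytilsol
  have husol : IsSolutionOn (zr : ℂ) (2 - σp') (2 - σm') (2 - γ') (2 - δ') (2 - ε')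
      (flipQ zr γ' δ' ε' q') (Ioo 0 1) u := by
    have e1 : (N : ℂ) + 1 = 2 - σp' := image_sigmaPlus s hsN
    have e2 : 2 - σm + N = 2 - σm' := image_sigmaMinus M a Λ s ω m hsN
    have e3 : 2 - γ + N = 2 - γ' := image_gamma M a Λ s ω m hsN
    have e4 : 2 - δ + N = 2 - δ' := image_delta M a Λ s ω m hsN
    have e5 : 2 - ε + N = 2 - ε' := image_eps M a Λ s ω m hsN
    have e6 := accessory_identity hsub s ω m lam hsN
    rw [e1, e2, e3, e4, e5, e6] at husol₀
    exact husol₀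
  have hF'' : (2 - γ') + (2 - δ') + (2 - ε') = (2 - σp') + (2 - σm') + 1 :=
    fuchs_flip (heun_fuchs hsub (-s) ω m)
  have hymsol : IsSolutionOn (zr : ℂ) σp' σm' γ' δ' ε' q' (Ioo 0 1) ym := by
    have h := isSolutionOn_flip hzr hF'' Subset.rfl husol
    simp only [sub_sub_cancel, flipQ_flipQ] at h
    exact h
  have hR'sol : IsRadialTeukolskySolution M a Λ (-s) ω m (lamFlip a Λ s lam) R' :=
    isRadialTeukolskySolution_of_heunSolution hsub hymsol
  -- (2) boundary shape at `x = 0` (event horizon): `ytil` is smooth across `0`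
  obtain ⟨e₀, he₀, G, hG, hyG⟩ := heunSolution_branch_at_zero hsub hin
  set e := min e₀ 1 with hedef
  have he : 0 < e := lt_min he₀ one_pos
  have he1 : e ≤ 1 := min_le_right _ _
  have hee₀ : e ≤ e₀ := min_le_left _ _
  set F : ℝ → ℂ := fun x => ((1 - x : ℝ) : ℂ) ^ (δ - 1) * ((zr - x : ℝ) : ℂ) ^ (ε - 1) * G x
    with hFdef
  have hFs : ContDiffOn ℝ ((⊤ : ℕ∞) : WithTop ℕ∞) F (Ioo (-e) e) := by
    have hG' : ContDiffOn ℝ ((⊤ : ℕ∞) : WithTop ℕ∞) G (Ioo (-e) e) :=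
      hG.mono (Ioo_subset_Ioo (by linarith) hee₀)
    refine (ContDiffOn.mul ?_ ?_).mul hG'
    · exact contDiffOn_cpow_comp ((contDiff_const.sub contDiff_id).contDiffOn)
        (fun x hx => by have := hx.1; have := hx.2; (try simp only [id]); linarith) _
    · exact contDiffOn_cpow_comp ((contDiff_const.sub contDiff_id).contDiffOn)
        (fun x hx => by have := hx.1; have := hx.2; (try simp only [id]); linarith) _
  have hagree0 : ∀ x ∈ Ioo 0 e, ytil x = F x := by
    intro x hx
    have hx0 : (0 : ℝ) < x := hx.1
    have hxG := hyG x ⟨hx0, lt_of_lt_of_le hx.2 hee₀⟩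
    simp only [hytil, hFdef, flipWeight]
    rw [show y x = (x : ℂ) ^ (1 - γ) * G x from hxG]
    have hc : (x : ℂ) ^ (γ - 1) * (x : ℂ) ^ (1 - γ) = 1 := by
      rw [cpow_mul_cpow_ofReal hx0, show γ - 1 + (1 - γ) = 0 by ring, Complex.cpow_zero]
    linear_combination ((1 - x : ℝ) : ℂ) ^ (δ - 1) * ((zr - x : ℝ) : ℂ) ^ (ε - 1) * G x * hc
  obtain ⟨hDF, huF⟩ := iterate_deriv_of_agree hFs hagree0 N
  have h0m : IsHeunBranchAtZero M a Λ (-s) ω m ym := by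
    refine ⟨e, he, fun x => ((1 - x : ℝ) : ℂ) ^ (1 - δ') * ((zr - x : ℝ) : ℂ) ^ (1 - ε') *
      (deriv^[N] F) x, ?_, fun x hx => ?_⟩
    · refine (ContDiffOn.mul ?_ ?_).mul hDF
      · exact contDiffOn_cpow_comp ((contDiff_const.sub contDiff_id).contDiffOn)
          (fun x hx => by have := hx.1; have := hx.2; (try simp only [id]); linarith) _
      · exact contDiffOn_cpow_comp ((contDiff_const.sub contDiff_id).contDiffOn)
          (fun x hx => by have := hx.1; have := hx.2; (try simp only [id]); linarith) _
    · simp only [hym, flipWeight]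
      rw [show u x = (deriv^[N] F) x from huF x hx]
      rw [show (2 : ℂ) - γ' - 1 = 1 - heunGamma M a Λ (-s) ω m by rw [hγ']; ring,
        show (2 : ℂ) - δ' - 1 = 1 - δ' by ring, show (2 : ℂ) - ε' - 1 = 1 - ε' by ring]
      ring
  -- (3) boundary shape at `x = 1` (cosmological horizon): `ytil = (1−x)^{δ−1}·G₁`
  obtain ⟨e₁, he₁, Fs, hFs1, hyF⟩ := heunSolution_smooth_at_one hsub s hout
  set d := min e₁ (min 1 (zr - 1)) with hddef
  have hd : 0 < d := lt_min he₁ (lt_min one_pos (by linarith))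
  have hd1 : d ≤ 1 := (min_le_right _ _).trans (min_le_left _ _)
  have hdz : d ≤ zr - 1 := (min_le_right _ _).trans (min_le_right _ _)
  have hde₁ : d ≤ e₁ := min_le_left _ _
  set G₁ : ℝ → ℂ := fun x => (x : ℂ) ^ (γ - 1) * ((zr - x : ℝ) : ℂ) ^ (ε - 1) * Fs x with hG₁def
  have hG₁ : ContDiffOn ℝ ((⊤ : ℕ∞) : WithTop ℕ∞) G₁ (Ioo (1 - d) (1 + d)) := by
    have hFs' : ContDiffOn ℝ ((⊤ : ℕ∞) : WithTop ℕ∞) Fs (Ioo (1 - d) (1 + d)) :=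
      hFs1.mono (Ioo_subset_Ioo (by linarith) (by linarith))
    refine (ContDiffOn.mul ?_ ?_).mul hFs'
    · have := contDiffOn_cpow_comp (g := fun x : ℝ => x) (U := Ioo (1 - d) (1 + d))
        contDiff_id.contDiffOn (fun x hx => by have := hx.1; have := hx.2; linarith) (γ - 1)
      simpa using this
    · exact contDiffOn_cpow_comp ((contDiff_const.sub contDiff_id).contDiffOn)
        (fun x hx => by have := hx.1; have := hx.2; (try simp only [id]); linarith) _
  have hbranch1 : ∀ x ∈ Ioo (1 - d) 1, ytil x = ((1 - x : ℝ) : ℂ) ^ (δ - 1) * G₁ x := by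
    intro x hx
    have hxF := hyF x ⟨by linarith [hx.1], hx.2⟩
    simp only [hytil, hG₁def, flipWeight]
    rw [show y x = Fs x from hxF]
    ring
  have hH := iterate_deriv_of_branch hG₁ hbranch1 N
  have hHs : ContDiffOn ℝ ((⊤ : ℕ∞) : WithTop ℕ∞) (branchCoeff (δ - 1) G₁ N) (Ioo (1 - d) (1 + d)) :=
    branchCoeff_smooth (δ - 1) isOpen_Ioo hG₁ N
  have h1m : IsHeunRegularAtOne ym := by
    refine ⟨d, hd, fun x => (x : ℂ) ^ (1 - γ') * ((zr - x : ℝ) : ℂ) ^ (1 - ε') *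
      branchCoeff (δ - 1) G₁ N x, ?_, fun x hx => ?_⟩
    · refine (ContDiffOn.mul ?_ ?_).mul hHs
      · have := contDiffOn_cpow_comp (g := fun x : ℝ => x) (U := Ioo (1 - d) (1 + d))
          contDiff_id.contDiffOn (fun x hx => by have := hx.1; have := hx.2; linarith) (1 - γ')
        simpa using this
      · exact contDiffOn_cpow_comp ((contDiff_const.sub contDiff_id).contDiffOn)
          (fun x hx => by have := hx.1; have := hx.2; (try simp only [id]); linarith) _
    · have hx1 : (0 : ℝ) < 1 - x := by linarith [hx.2]
      simp only [hym, flipWeight]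
      rw [show u x = (deriv^[N] ytil) x from rfl, hH x hx]
      have hexp : ((1 - x : ℝ) : ℂ) ^ ((2 : ℂ) - δ' - 1) * ((1 - x : ℝ) : ℂ) ^ (δ - 1 - (N : ℕ)) = 1 := by
        rw [cpow_mul_cpow_ofReal hx1]
        have : (2 : ℂ) - δ' - 1 + (δ - 1 - (N : ℕ)) = 0 := by
          have := delta_sub_delta M a Λ s ω m hsN
          rw [← hδ, ← hδ'] at this
          linear_combination this
        rw [this, Complex.cpow_zero]
      rw [show (2 : ℂ) - γ' - 1 = 1 - γ' by ring, show (2 : ℂ) - ε' - 1 = 1 - ε' by ring]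
      linear_combination (x : ℂ) ^ (1 - γ') * ((zr - x : ℝ) : ℂ) ^ (1 - ε') *
        branchCoeff (δ - 1) G₁ N x * hexp
  have hin' : IsIngoingAtEventHorizon M a Λ (-s) ω m R' :=
    isIngoingAtEventHorizon_of_heun_branch_at_zero hsub (-s) ω m h0m
  have hout' : IsOutgoingAtCosmoHorizon M a Λ ω m R' :=
    isOutgoingAtCosmoHorizon_of_heun_smooth_at_one hsub (-s) ω m h1m
  refine ⟨R', hR'sol, hin', hout', fun hR'0 => ?_⟩
  -- (4) consequences of `R' ≡ 0`
  have hz1 := one_lt_mobiusZinf hsub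
  have hym0 : ∀ x ∈ Ioo (0 : ℝ) 1, ym x = 0 := by
    intro x hx
    have hxinf : x ≠ mobiusZinf M a Λ := ne_of_lt (hx.2.trans hz1)
    have hρx : ρ x ∈ Ioo (rPlus M a Λ) (rCosmo M a Λ) := mobiusInv_mem_Ioo hsub hx
    have h := hR'0 (ρ x) hρx
    simp only [hR'] at h
    rw [hρ, mobiusZ_mobiusInv hsub hxinf] at h
    exact (mul_eq_zero.mp h).resolve_left (heunWeight_ne_zero hsub (-s) ω m hρx)
  have hu0 : ∀ x ∈ Ioo (0 : ℝ) 1, u x = 0 := fun x hx =>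
    (flip_eq_zero_iff hzr (2 - γ') (2 - δ') (2 - ε') hx).mp (hym0 x hx)
  -- `ytil ≡ 0 ⇒ R ≡ 0`
  have hR_of_ytil : (∀ x ∈ Ioo (0 : ℝ) 1, ytil x = 0) →
      ∀ r ∈ Ioo (rPlus M a Λ) (rCosmo M a Λ), R r = 0 := by
    intro hytil0 r hr
    have hx : mobiusZ M a Λ r ∈ Ioo (0 : ℝ) 1 := mobiusZ_mem_Ioo hsub hr
    have hy0 : y (mobiusZ M a Λ r) = 0 := (flip_eq_zero_iff hzr γ δ ε hx).mp (hytil0 _ hx)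
    have hrm : r ≠ rMinus M a Λ := by
      obtain ⟨-, -, h01, -⟩ := hsub
      intro h; rw [h] at hr; exact absurd hr.1 (not_lt.mpr h01.le)
    simp only [hy, hρ, mobiusInv_mobiusZ hsub hrm] at hy0
    exact (div_eq_zero_iff.mp hy0).resolve_right (heunWeight_ne_zero hsub s ω m hr)
  refine ⟨fun hoff => ?_, fun hext => ?_⟩
  · -- (a) injectivity off the lattice
    have hoff' : ∀ k : ℤ, k ≤ (N : ℤ) - 1 → δ - 1 ≠ k := by
      intro k hk
      rw [hδ, delta_sub_one]
      refine hoff k ?_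
      have hk' : ((k : ℤ) : ℝ) ≤ ((N : ℤ) : ℝ) - 1 := by exact_mod_cast hk
      push_cast at hk'
      linarith
    exact hR_of_ytil
      (eq_zero_of_iterate_deriv_eq_zero_of_branch hytil_smooth hu0 hd hd1 hG₁ hbranch1 hoff')
  · -- (b) the extreme stratum `δ − 1 = N − 1`: `ytil = c (1−x)^{N−1}`
    have hμ : δ - 1 = (N : ℂ) - 1 := by rw [hδ, delta_sub_one]; exact hext
    have hbranch1' : ∀ x ∈ Ioo (1 - d) 1, ytil x = ((1 - x : ℝ) : ℂ) ^ ((N : ℂ) - 1) * G₁ x := by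
      intro x hx; rw [← hμ]; exact hbranch1 x hx
    obtain ⟨c, hc⟩ :=
      eq_monomial_of_iterate_deriv_eq_zero_of_branch_extreme hytil_smooth hu0 hd hd1 hG₁ hbranch1'
    by_cases hc0 : c = 0
    · left
      exact hR_of_ytil fun x hx => by rw [hc x hx, hc0, zero_mul]
    · right
      have hsol' : IsSolutionOn (zr : ℂ) (2 - σp) (2 - σm) (2 - γ) (2 - δ) (2 - ε)
          (flipQ zr γ δ ε q) (Ioo 0 1) (fun x => c * ((1 - x : ℝ) : ℂ) ^ (N - 1)) :=
        SpinFlipTS.IsSolutionOn.congr_eqOn isOpen_Ioo hytilsol (fun x hx => hc x hx)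
      have hacc := accessory_of_monomial_solution hc0 hsol'
      have hN' : (((N - 1 : ℕ) : ℕ) : ℂ) = (N : ℂ) - 1 := by
        rw [Nat.cast_sub hN1]; push_cast; ring
      rw [hN'] at hacc
      exact hacc

/-- **THE SPIN FLIP IS A THEOREM (off the lattice)** — `RouteW.SpinFlipTS` holds: the image `R'`
of `spinFlip_core` with its injectivity clause (a). PROVED, 0 cited facts. -/
theorem spinFlipTS_holds : SpinFlipTS := by
  intro M a Λ s ω m lam R N hsub hN1 hsN hR hin hout
  obtain ⟨R', h1, h2, h3, h4⟩ := spinFlip_core M a Λ s ω m lam R N hsub hN1 hsN hR hin hout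
  exact ⟨R', h1, h2, h3, fun hoff hR'0 => (h4 hR'0).1 hoff⟩

end RouteW

end Summit.Ventures.KdS
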